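import Literature.Probability.Percolation.VoronoiColourSymmetry
import Literature.Probability.RandomPlanarGeometry.ConformalRectangleInsertMark
import Summits.CriticalPhenomena.CardyFormulaZ2.Theorems.CardyFlipRussoTargetStubVoronoiBoundarySumDuality
import HarnessLib

/-!
# Stub `stub_voronoiBoundarySum` of line `Sketch` (crux `Target`, stmt-CriticalPhenomena-6431)

The second half of the Claim-23 estimate of Bollobás–Riordan (*Percolation* (2006), Ch. 7,
p. 201: "`f_δ¹(z_δ) + f_δ²(z_δ) = 1 − o(1)`") for the ANNEALED Poisson–Voronoi separating
probabilities `fʲ = voronoiSepProb (PB.prod PW) (forgetLast R₀) δ j` (paths in `closure Ω`, closed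
colours), in ∀-sequence form, FROM Tassion's one-arm estimate F1 (`VoronoiAnnealedOneArm`) AND the
exclusion half of continuum colour duality (the second hypothesis = the fact stub
`stub_voronoiExclusion` of the line, v8.2): for a point `z` of the open arc `Aᵢ` of the 3-marked
domain `D = forgetLast R₀` and points `z_δ → z` of `Ω`, `f^{i+1}(z_δ) + f^{i+2}(z_δ) → 1`.

Proof (the dossier's plan).  Split `Aᵢ` at `z = boundary u` and let `R = (Ω; z, Pᵢ₊₁, Pᵢ₊₂, Pᵢ)`
be the re-marked conformal rectangle (`MarkedDomain.exists_insertMark`: arcs `R.arc 0 = [z, Pᵢ₊₁]`,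
`R.arc 1 = Aᵢ₊₁`, `R.arc 2 = Aᵢ₊₂`, `R.arc 3 = [Pᵢ, z]`).  The arcs `Aᵢ₊₁ ∪ Aᵢ₊₂` stay at distance
`≥ r > 0` from `z`; F1 gives `ε` with `P[N] ≤ β/8` eventually, `N` = "a black arm from `B̄(z, ε)`
to `{dist · z ≥ r}`", and `closure Ω` is uniformly locally path connected
(`exists_joinedIn_closure_ball`), so `z_δ` is joined to `z` inside `closure Ω ∩ B(z, ε)` once
`δ` is small.  Then, deterministically and exactly as at a corner
(`corner_crossing_imp` / `corner_sepEvent_imp`, interlacing lemma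
`ConformalRectangle.inter_nonempty_of_interlaced`):
`E^{i+1}(z_δ) Δ H₁ ⊆ N` and `E^{i+2}(z_δ) Δ H₂ ⊆ N`, where `H₁` = black crossing
`R.arc 0 ↔ R.arc 2` and `H₂` = black crossing `R.arc 1 ↔ R.arc 3` of `closure Ω`
(`bsum_sepEvent_imp_crossing₀₂`, `bsum_crossing₀₂_imp_sepEvent`, `bsum_sepEvent_imp_crossing₁₃`,
`bsum_crossing₁₃_imp_sepEvent`).  By colour symmetry
(`IsPoissonPointProcess.measureReal_voronoiCrossing_swap`) `P[H₂] = P[H₂ʷ]` with `H₂ʷ` the WHITE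
crossing `R.arc 1 ↔ R.arc 3`, and by the landed duality identity
(`measureReal_voronoiCrossing_add_whiteCrossing`) `P[H₁] + P[H₂ʷ] = 1 + P[H₁ ∩ H₂ʷ]`; the
exclusion hypothesis applied to `R` says `P[H₁ ∩ H₂ʷ] → 0`.  Hence
`|f^{i+1}(z_δ) + f^{i+2}(z_δ) - 1| ≤ 2 P[N] + P[H₁ ∩ H₂ʷ] < β` eventually.
-/

noncomputable section

namespace Summit.CriticalPhenomena.CardyFormulaZ2.Theorems.CardyFlipRussoTarget

open MeasureTheory Filter Set Metric
open scoped Topology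
open Literature.Analysis.FunctionSpaces
open Literature.Probability.RandomPlanarGeometry
open Literature.Probability.RandomPlanarGeometry.MarkedDomain (forgetLast)
open Literature.Probability.LatticeModels
open Literature.Probability.Percolation
open Literature.Topology.PlaneTopology

/-! ### The four deterministic inclusions in the re-marked rectangle -/

section Deterministic

variable {D : MarkedDomain 3} {R : ConformalRectangle} {j : Fin 3} {δ ε ρ : ℝ} {z z' : ℂ}
  {B W : Set ℂ}

/-- A join along a boundary arc of `R` missed by a path `γ` is a join in `closure Ω` off `γ`. -/
theorem bsum_joinedIn_arc_diff (hcar : R.carrier = D.carrier) (k : Fin 4) {x y a b : ℂ}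
    (hx : x ∈ R.arc k) (hy : y ∈ R.arc k) (γ : Path a b) (hmiss : ¬ ∃ t, γ t ∈ R.arc k) :
    JoinedIn (closure D.carrier \ range γ) x y := by
  refine (R.joinedIn_arc k hx hy).mono fun q hq => ⟨?_, ?_⟩
  · rw [← hcar]
    exact frontier_subset_closure (R.arc_subset_frontier k hq)
  · rintro ⟨s, rfl⟩
    exact hmiss ⟨s, hq⟩

/-- **`Eʲ(z') ⊆ H₁ ∪ N`.**  In the re-marked rectangle `R` (`R.arc 1 = Aⱼ`, `R.arc 2 = Aⱼ₊₁`,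
`z ∈ R.arc 0`, `R.arc 2` `ρ`-far from `z`), if `z'` is joined to `z` inside
`closure Ω ∩ B(z, ε)`, a black `Aⱼ₊₁`–`Aⱼ₊₂` path `γ` cutting `z'` from `Aⱼ` either meets
`R.arc 0` — its initial piece is a black crossing `R.arc 0 ↔ R.arc 2` — or contains a black arm at
`z`; for if it missed both `R.arc 0` and `B(z, ε)`, the arc `R.arc 0` run from `z` to
`R.pt 1 ∈ Aⱼ`, prefixed by the join of `z'` to `z`, would join `z'` to `Aⱼ` off `γ`. -/
theorem bsum_sepEvent_imp_crossing₀₂ (hcar : R.carrier = D.carrier) (h1 : R.arc 1 = D.arc j)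
    (h2 : R.arc 2 = D.arc (j + 1)) (hz0 : z ∈ R.arc 0) (hfar : ∀ x ∈ R.arc 2, ρ ≤ dist x z)
    (hτ : JoinedIn (closure D.carrier ∩ ball z ε) z z') (hE : voronoiSepEvent D δ j z' B W) :
    voronoiCrossing R.carrier (R.arc 0) (R.arc 2) δ B W ∨
      ∃ (a b : ℂ) (γ : Path a b), dist a z ≤ ε ∧ ρ ≤ dist b z ∧
        ∀ t, (γ t : ℂ) / (δ : ℂ) ∈ blackRegion B W := by
  obtain ⟨x, hx, y, -, γ, hγ, hcut⟩ := hE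
  have hx2 : x ∈ R.arc 2 := by rw [h2]; exact hx
  by_cases h0 : ∃ t, γ t ∈ R.arc 0
  · -- the initial piece of `γ`, from `x ∈ R.arc 2` to a point of `R.arc 0`, is a crossing
    obtain ⟨t, ht⟩ := h0
    obtain ⟨a, b, γ', ha, hb, hsub⟩ := exists_subpath γ t 0
    have hJ : JoinedIn (closure R.carrier ∩ {w | w / (δ : ℂ) ∈ blackRegion B W}) a b := by
      refine ⟨γ', fun s => ?_⟩
      obtain ⟨u, hu⟩ := hsub ⟨s, rfl⟩
      rw [← hu, hcar]
      exact hγ u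
    rw [ha, hb, γ.source] at hJ
    exact Or.inl ⟨γ t, ht, x, hx2, hJ⟩
  by_cases hnear : ∃ t, γ t ∈ ball z ε
  · -- a black arm at `z`: `γ` reversed, from the ball back to `x ∈ R.arc 2`
    obtain ⟨t, ht⟩ := hnear
    refine Or.inr (corner_arm_of_mem_ball γ.symm (fun s => ?_) (t := unitInterval.symm t) ?_
      (hfar x hx2))
    · rw [Path.symm_apply]
      exact (hγ _).2
    · show γ (unitInterval.symm (unitInterval.symm t)) ∈ ball z ε
      rwa [unitInterval.symm_symm]
  -- otherwise `z'` is joined to `R.pt 1 ∈ Aⱼ` off `γ`: contradiction with the cut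
  exfalso
  have h01 : JoinedIn (closure D.carrier \ range γ) z' (R.pt 1) :=
    (joinedIn_diff_of_forall_notMem_ball γ hnear hτ).symm.trans
      (bsum_joinedIn_arc_diff hcar 0 hz0 (R.pt_succ_mem_arc 0) γ h0)
  exact hcut.2 (R.pt 1) (by rw [← h1]; exact R.pt_mem_arc_self 1) h01

/-- **`H₁ ⊆ Eʲ(z') ∪ N`.**  Under the same bookkeeping (and `R.arc 0 ⊆ Aⱼ₊₂`, `z ∈ R.arc 3`), a
black crossing of `closure Ω` from `R.arc 0` to `R.arc 2` either contains a black arm at `z` or,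
reversed, is a black `Aⱼ₊₁`–`Aⱼ₊₂` path cutting `z'` from `Aⱼ = R.arc 1`: a join of `z'` to
`R.arc 1` off it, prefixed by the join of `z ∈ R.arc 3` to `z'`, would contradict the interlacing
lemma. -/
theorem bsum_crossing₀₂_imp_sepEvent (hcar : R.carrier = D.carrier) (h1 : R.arc 1 = D.arc j)
    (h2 : R.arc 2 = D.arc (j + 1)) (h0 : R.arc 0 ⊆ D.arc (j + 2)) (hz3 : z ∈ R.arc 3)
    (hfar : ∀ x ∈ R.arc 2, ρ ≤ dist x z) (hτ : JoinedIn (closure D.carrier ∩ ball z ε) z z')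
    (hV : voronoiCrossing R.carrier (R.arc 0) (R.arc 2) δ B W) :
    voronoiSepEvent D δ j z' B W ∨
      ∃ (a b : ℂ) (γ : Path a b), dist a z ≤ ε ∧ ρ ≤ dist b z ∧
        ∀ t, (γ t : ℂ) / (δ : ℂ) ∈ blackRegion B W := by
  obtain ⟨p, hp, q, hq, hJ⟩ := hV
  have hcl : closure R.carrier = closure D.carrier := by rw [hcar]
  have hγm : ∀ t, hJ.somePath t ∈ closure D.carrier ∩ {w | w / (δ : ℂ) ∈ blackRegion B W} :=
    fun t => hcl ▸ hJ.somePath_mem t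
  by_cases hnear : ∃ t, hJ.somePath t ∈ ball z ε
  · obtain ⟨t, ht⟩ := hnear
    exact Or.inr (corner_arm_of_mem_ball hJ.somePath (fun t => (hγm t).2) ht (hfar q hq))
  set γ : Path q p := hJ.somePath.symm with hγdef
  have hγ : ∀ t, γ t ∈ closure D.carrier ∩ {w | w / (δ : ℂ) ∈ blackRegion B W} := fun t => by
    rw [hγdef, Path.symm_apply]
    exact hγm _
  have hnear' : ¬ ∃ t, γ t ∈ ball z ε := by
    rintro ⟨t, ht⟩
    rw [hγdef, Path.symm_apply] at ht
    exact hnear ⟨_, ht⟩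
  refine Or.inl ⟨q, by rw [← h2]; exact hq, p, h0 hp, γ, hγ, ?_, ?_⟩
  · -- `z'`, the endpoint of the join, lies in the ball missed by `γ`
    rintro ⟨t, ht⟩
    exact hnear' ⟨t, by rw [ht]; exact hτ.target_mem.2⟩
  · -- no point of `Aⱼ = R.arc 1` is joined to `z'` off `γ` (interlacing)
    intro a ha hσ
    have hza : JoinedIn (closure D.carrier \ range γ) z a :=
      (joinedIn_diff_of_forall_notMem_ball γ hnear' hτ).trans hσ
    have hLsub : range hza.somePath ⊆ closure D.carrier \ range γ := by
      rintro _ ⟨s, rfl⟩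
      exact hza.somePath_mem s
    obtain ⟨w, hwK, hwL⟩ := ConformalRectangle.inter_nonempty_of_interlaced R
      (isCompact_range γ.continuous) (isConnected_range γ.continuous).isPreconnected
      (fun _ ⟨t, ht⟩ => ht ▸ hcl ▸ (hγ t).1) ⟨p, ⟨1, γ.target⟩, hp⟩ ⟨q, ⟨0, γ.source⟩, hq⟩
      (isCompact_range hza.somePath.continuous)
      (isConnected_range hza.somePath.continuous).isPreconnected
      (fun w hw => hcl ▸ (hLsub hw).1)
      ⟨a, ⟨1, hza.somePath.target⟩, by rw [h1]; exact ha⟩ ⟨z, ⟨0, hza.somePath.source⟩, hz3⟩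
    exact (hLsub hwL).2 hwK

/-- **`Eᵏ(z') ⊆ H₂ ∪ N`.**  In the re-marked rectangle `R` (`R.arc 1 = Aₖ₊₂`, `R.arc 2 = Aₖ`,
`z ∈ R.arc 3`, `R.arc 1` `ρ`-far from `z`), a black `Aₖ₊₁`–`Aₖ₊₂` path `γ` cutting `z'` from `Aₖ`
either meets `R.arc 3` — its final piece is a black crossing `R.arc 1 ↔ R.arc 3` — or contains a
black arm at `z`; for if it missed both `R.arc 3` and `B(z, ε)`, the arc `R.arc 3` run back from
`z` to `R.pt 3 ∈ Aₖ`, prefixed by the join of `z'` to `z`, would join `z'` to `Aₖ` off `γ`. -/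
theorem bsum_sepEvent_imp_crossing₁₃ (hcar : R.carrier = D.carrier) (h1 : R.arc 1 = D.arc (j + 2))
    (h2 : R.arc 2 = D.arc j) (hz3 : z ∈ R.arc 3) (hfar : ∀ x ∈ R.arc 1, ρ ≤ dist x z)
    (hτ : JoinedIn (closure D.carrier ∩ ball z ε) z z') (hE : voronoiSepEvent D δ j z' B W) :
    voronoiCrossing R.carrier (R.arc 1) (R.arc 3) δ B W ∨
      ∃ (a b : ℂ) (γ : Path a b), dist a z ≤ ε ∧ ρ ≤ dist b z ∧
        ∀ t, (γ t : ℂ) / (δ : ℂ) ∈ blackRegion B W := by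
  obtain ⟨x, -, y, hy, γ, hγ, hcut⟩ := hE
  have hy1 : y ∈ R.arc 1 := by rw [h1]; exact hy
  by_cases h3 : ∃ t, γ t ∈ R.arc 3
  · -- the final piece of `γ`, from a point of `R.arc 3` to `y ∈ R.arc 1`, is a crossing
    obtain ⟨t, ht⟩ := h3
    obtain ⟨a, b, γ', ha, hb, hsub⟩ := exists_subpath γ 1 t
    have hJ : JoinedIn (closure R.carrier ∩ {w | w / (δ : ℂ) ∈ blackRegion B W}) a b := by
      refine ⟨γ', fun s => ?_⟩
      obtain ⟨u, hu⟩ := hsub ⟨s, rfl⟩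
      rw [← hu, hcar]
      exact hγ u
    rw [ha, hb, γ.target] at hJ
    exact Or.inl ⟨y, hy1, γ t, ht, hJ⟩
  by_cases hnear : ∃ t, γ t ∈ ball z ε
  · obtain ⟨t, ht⟩ := hnear
    exact Or.inr (corner_arm_of_mem_ball γ (fun s => (hγ s).2) ht (hfar y hy1))
  -- otherwise `z'` is joined to `R.pt 3 ∈ Aₖ` off `γ`: contradiction with the cut
  exfalso
  have h33 : JoinedIn (closure D.carrier \ range γ) z' (R.pt 3) :=
    (joinedIn_diff_of_forall_notMem_ball γ hnear hτ).symm.trans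
      (bsum_joinedIn_arc_diff hcar 3 hz3 (R.pt_mem_arc_self 3) γ h3)
  exact hcut.2 (R.pt 3) (by rw [← h2]; exact R.pt_succ_mem_arc 2) h33

/-- **`H₂ ⊆ Eᵏ(z') ∪ N`.**  Under the same bookkeeping (and `R.arc 3 ⊆ Aₖ₊₁`, `z ∈ R.arc 0`), a
black crossing of `closure Ω` between `R.arc 1` and `R.arc 3` either contains a black arm at `z`
or, run from `R.arc 3` to `R.arc 1`, is a black `Aₖ₊₁`–`Aₖ₊₂` path cutting `z'` from
`Aₖ = R.arc 2` (interlacing, the join of `z ∈ R.arc 0` to `z'` as prefix). -/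
theorem bsum_crossing₁₃_imp_sepEvent (hcar : R.carrier = D.carrier) (h1 : R.arc 1 = D.arc (j + 2))
    (h2 : R.arc 2 = D.arc j) (h3 : R.arc 3 ⊆ D.arc (j + 1)) (hz0 : z ∈ R.arc 0)
    (hfar : ∀ x ∈ R.arc 1, ρ ≤ dist x z) (hτ : JoinedIn (closure D.carrier ∩ ball z ε) z z')
    (hV : voronoiCrossing R.carrier (R.arc 1) (R.arc 3) δ B W) :
    voronoiSepEvent D δ j z' B W ∨
      ∃ (a b : ℂ) (γ : Path a b), dist a z ≤ ε ∧ ρ ≤ dist b z ∧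
        ∀ t, (γ t : ℂ) / (δ : ℂ) ∈ blackRegion B W := by
  obtain ⟨p, hp, q, hq, hJ⟩ := hV
  have hcl : closure R.carrier = closure D.carrier := by rw [hcar]
  set γ : Path q p := hJ.somePath.symm with hγdef
  have hγ : ∀ t, γ t ∈ closure D.carrier ∩ {w | w / (δ : ℂ) ∈ blackRegion B W} := fun t => by
    rw [hγdef, Path.symm_apply, ← hcl]
    exact hJ.somePath_mem _
  by_cases hnear : ∃ t, γ t ∈ ball z ε
  · obtain ⟨t, ht⟩ := hnear
    exact Or.inr (corner_arm_of_mem_ball γ (fun t => (hγ t).2) ht (hfar p hp))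
  refine Or.inl ⟨q, h3 hq, p, by rw [← h1]; exact hp, γ, hγ, ?_, ?_⟩
  · rintro ⟨t, ht⟩
    exact hnear ⟨t, by rw [ht]; exact hτ.target_mem.2⟩
  · -- no point of `Aₖ = R.arc 2` is joined to `z'` off `γ` (interlacing)
    intro a ha hσ
    have hza : JoinedIn (closure D.carrier \ range γ) z a :=
      (joinedIn_diff_of_forall_notMem_ball γ hnear hτ).trans hσ
    have hLsub : range hza.somePath ⊆ closure D.carrier \ range γ := by
      rintro _ ⟨s, rfl⟩
      exact hza.somePath_mem s
    obtain ⟨w, hwL, hwK⟩ := ConformalRectangle.inter_nonempty_of_interlaced R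
      (isCompact_range hza.somePath.continuous)
      (isConnected_range hza.somePath.continuous).isPreconnected
      (fun w hw => hcl ▸ (hLsub hw).1)
      ⟨z, ⟨0, hza.somePath.source⟩, hz0⟩ ⟨a, ⟨1, hza.somePath.target⟩, by rw [h2]; exact ha⟩
      (isCompact_range γ.continuous) (isConnected_range γ.continuous).isPreconnected
      (fun _ ⟨t, ht⟩ => ht ▸ hcl ▸ (hγ t).1) ⟨p, ⟨1, γ.target⟩, hp⟩ ⟨q, ⟨0, γ.source⟩, hq⟩
    exact (hLsub hwL).2 hwK

end Deterministic

/-! ### The estimate -/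

/-- STUB 3c″ of line `Sketch` — **the boundary sum `f^{i+1}(z_δ) + f^{i+2}(z_δ) → 1` of the
annealed Voronoi separating probabilities from F1 and the exclusion half of continuum colour
duality** (Bollobás–Riordan, proof of Claim 23, p. 201, ∀-sequence form): the registered
signature.  See the module docstring for the proof. -/
theorem stub_voronoiBoundarySum : VoronoiAnnealedOneArm →
    (∀ (PB PW : Measure (PointConfig ℂ)),
      IsPoissonPointProcess (volume : Measure ℂ) PB → IsPoissonPointProcess (volume : Measure ℂ) PW →
      ∀ R : ConformalRectangle,
        Tendsto (fun δ : ℝ => (PB.prod PW).real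
          {c | voronoiCrossing R.carrier (R.arc 0) (R.arc 2) δ (c.1 : Set ℂ) (c.2 : Set ℂ) ∧
               voronoiCrossing R.carrier (R.arc 1) (R.arc 3) δ (c.2 : Set ℂ) (c.1 : Set ℂ)})
          (𝓝[>] 0) (𝓝 0)) →
    ∀ (PB PW : Measure (PointConfig ℂ)),
    IsPoissonPointProcess (volume : Measure ℂ) PB → IsPoissonPointProcess (volume : Measure ℂ) PW →
    ∀ (R : ConformalRectangle) (i : Fin 3),
      ∀ z ∈ (forgetLast R).boundary '' Ioo ((forgetLast R).mark i) ((forgetLast R).nextMark i),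
        ∀ zs : ℝ → ℂ, (∀ᶠ δ : ℝ in 𝓝[>] 0, zs δ ∈ R.carrier) →
          Tendsto zs (𝓝[>] 0) (𝓝 z) →
          Tendsto (fun δ => voronoiSepProb (PB.prod PW) (forgetLast R) δ (i + 1) (zs δ) +
              voronoiSepProb (PB.prod PW) (forgetLast R) δ (i + 2) (zs δ)) (𝓝[>] 0) (𝓝 1) := by
  intro hF1 hEx PB PW hB hW R₀ i z hz zs hzs hlim
  haveI := hB.isProbabilityMeasure
  haveI := hW.isProbabilityMeasure
  set D : MarkedDomain 3 := forgetLast R₀ with hD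
  obtain ⟨u, hu, huz⟩ := hz
  -- the re-marked rectangle `R = (Ω; z, Pᵢ₊₁, Pᵢ₊₂, Pᵢ)`
  obtain ⟨R, hcar, hpt, a0, a1, a2, a3⟩ := D.exists_insertMark i hu
  obtain ⟨hsub0, hsub3⟩ := D.image_Icc_subset_arc_of_mem_Ioo i hu
  rw [huz] at hpt
  have hz0 : z ∈ R.arc 0 := hpt ▸ R.pt_mem_arc_self 0
  have hz3 : z ∈ R.arc 3 := hpt ▸ R.pt_succ_mem_arc 3
  have h0 : R.arc 0 ⊆ D.arc i := a0 ▸ hsub0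
  have h3 : R.arc 3 ⊆ D.arc i := a3 ▸ hsub3
  have hzcl : z ∈ closure D.carrier := by
    rw [← hcar]
    exact frontier_subset_closure (R.arc_subset_frontier 0 hz0)
  -- index bookkeeping in `Fin 3`
  have e1 : ∀ j : Fin 3, j + 1 + 1 = j + 2 := by decide
  have e2 : ∀ j : Fin 3, j + 1 + 2 = j := by decide
  have e3 : ∀ j : Fin 3, j + 2 + 1 = j := by decide
  have e4 : ∀ j : Fin 3, j + 2 + 2 = j + 1 := by decide
  have hne1 : ∀ j : Fin 3, j + 1 ≠ j := by decide
  have hne2 : ∀ j : Fin 3, j + 2 ≠ j := by decide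
  -- the other arcs are `r`-far from `z`
  obtain ⟨r, hr0, -, hfar⟩ := D.exists_pos_forall_mem_arc_of_dist_lt i hu
  rw [huz] at hfar
  have hfar1 : ∀ x ∈ R.arc 1, r ≤ dist x z := fun x hx =>
    hfar (i + 1) (hne1 i) x (by rw [← a1]; exact hx)
  have hfar2 : ∀ x ∈ R.arc 2, r ≤ dist x z := fun x hx =>
    hfar (i + 2) (hne2 i) x (by rw [← a2]; exact hx)
  rw [Metric.tendsto_nhds]
  intro β hβ
  obtain ⟨ε, ⟨hε0, -⟩, hF1ev⟩ := hF1.exists_radius hB hW (by positivity : (0 : ℝ) < β / 8) hr0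
  obtain ⟨η, hη0, hjoin⟩ := exists_joinedIn_closure_ball D.toJordanDomain hε0
  have hclose : ∀ᶠ δ : ℝ in 𝓝[>] 0, dist (zs δ) z < η := Metric.tendsto_nhds.1 hlim _ hη0
  have hexcl := Metric.tendsto_nhds.1 (hEx PB PW hB hW R) _ (half_pos hβ)
  have hpos : ∀ᶠ δ : ℝ in 𝓝[>] 0, δ ∈ Ioi (0 : ℝ) := self_mem_nhdsWithin
  filter_upwards [hF1ev, hzs, hclose, hexcl, hpos] with δ hδ1 hδ2 hδ3 hδ4 hδ5
  have hδ : (0 : ℝ) < δ := hδ5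
  have hτ : JoinedIn (closure D.carrier ∩ ball z ε) z (zs δ) :=
    hjoin z hzcl (zs δ) (subset_closure hδ2) (by rw [dist_comm]; exact hδ3)
  set P := PB.prod PW with hP
  set E₁ : Set (PointConfig ℂ × PointConfig ℂ) :=
    {c | voronoiSepEvent D δ (i + 1) (zs δ) (c.1 : Set ℂ) (c.2 : Set ℂ)} with hE₁
  set E₂ : Set (PointConfig ℂ × PointConfig ℂ) :=
    {c | voronoiSepEvent D δ (i + 2) (zs δ) (c.1 : Set ℂ) (c.2 : Set ℂ)} with hE₂
  set H₁ : Set (PointConfig ℂ × PointConfig ℂ) :=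
    {c | voronoiCrossing R.carrier (R.arc 0) (R.arc 2) δ (c.1 : Set ℂ) (c.2 : Set ℂ)} with hH₁
  set H₂ : Set (PointConfig ℂ × PointConfig ℂ) :=
    {c | voronoiCrossing R.carrier (R.arc 1) (R.arc 3) δ (c.1 : Set ℂ) (c.2 : Set ℂ)} with hH₂
  set H₂w : Set (PointConfig ℂ × PointConfig ℂ) :=
    {c | voronoiCrossing R.carrier (R.arc 1) (R.arc 3) δ (c.2 : Set ℂ) (c.1 : Set ℂ)} with hH₂w
  set G : Set (PointConfig ℂ × PointConfig ℂ) :=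
    {c | voronoiCrossing R.carrier (R.arc 0) (R.arc 2) δ (c.1 : Set ℂ) (c.2 : Set ℂ) ∧
      voronoiCrossing R.carrier (R.arc 1) (R.arc 3) δ (c.2 : Set ℂ) (c.1 : Set ℂ)} with hG
  set N : Set (PointConfig ℂ × PointConfig ℂ) :=
    {c | ∃ (a b : ℂ) (γ : Path a b), dist a z ≤ ε ∧ r ≤ dist b z ∧
      ∀ t, (γ t : ℂ) / (δ : ℂ) ∈ blackRegion (c.1 : Set ℂ) (c.2 : Set ℂ)} with hN
  -- the four inclusions
  have i1 : E₁ ⊆ H₁ ∪ N := fun c hc =>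
    bsum_sepEvent_imp_crossing₀₂ hcar a1 (by rw [e1]; exact a2) hz0 hfar2 hτ hc
  have i2 : H₁ ⊆ E₁ ∪ N := fun c hc =>
    bsum_crossing₀₂_imp_sepEvent hcar a1 (by rw [e1]; exact a2) (by rw [e2]; exact h0) hz3 hfar2
      hτ hc
  have i3 : E₂ ⊆ H₂ ∪ N := fun c hc =>
    bsum_sepEvent_imp_crossing₁₃ hcar (by rw [e4]; exact a1) a2 hz3 hfar1 hτ hc
  have i4 : H₂ ⊆ E₂ ∪ N := fun c hc =>
    bsum_crossing₁₃_imp_sepEvent hcar (by rw [e4]; exact a1) a2 (by rw [e3]; exact h3) hz0 hfar1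
      hτ hc
  have b1 : P.real E₁ ≤ P.real H₁ + P.real N :=
    (measureReal_mono i1).trans (measureReal_union_le _ _)
  have b2 : P.real H₁ ≤ P.real E₁ + P.real N :=
    (measureReal_mono i2).trans (measureReal_union_le _ _)
  have b3 : P.real E₂ ≤ P.real H₂ + P.real N :=
    (measureReal_mono i3).trans (measureReal_union_le _ _)
  have b4 : P.real H₂ ≤ P.real E₂ + P.real N :=
    (measureReal_mono i4).trans (measureReal_union_le _ _)
  -- colour symmetry, the duality identity, exclusion and F1
  have hsymm : P.real H₂w = P.real H₂ :=
    hB.measureReal_voronoiCrossing_swap hW R.carrier (R.arc 1) (R.arc 3) δ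
  have hid : P.real H₁ + P.real H₂w = 1 + P.real G :=
    measureReal_voronoiCrossing_add_whiteCrossing P R hδ
  have hG0 : 0 ≤ P.real G := measureReal_nonneg
  have hGβ : P.real G < β / 2 := by
    have h := hδ4
    rwa [Real.dist_eq, sub_zero, abs_of_nonneg measureReal_nonneg] at h
  have hNβ : P.real N ≤ β / 8 := hδ1 z
  rw [Real.dist_eq]
  show |P.real E₁ + P.real E₂ - 1| < β
  rw [abs_sub_lt_iff]
  constructor <;> linarith

end Summit.CriticalPhenomena.CardyFormulaZ2.Theorems.CardyFlipRussoTarget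

end
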